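import Summits.HodgeConjecture.HodgeConjecture.Theses.SplitImpliesAll
import Summits.HodgeConjecture.HodgeConjecture.Theorems.Ring2AbelianAllLandherr
import HarnessLib

/-!
# `SplitImpliesAll.SplitSixfoldCells` ⟸ the printed split-sixfold theorems, BY NAME — and the route's reach modulo print

SUPPORT file for item stmt-HodgeConjecture-19150 (`SplitSixfoldCells`, the route's declared RESIDUAL: every split sixfold cell
`(ℚ(√-d), 6, [(-1)³])` has algebraic Weil classes). The item stays OPEN: the inputs are named Literature facts (hypotheses here,
never asserted). Readings, all through ring 2's Landherr-discharged cell theorems (`Ring2AbelianAllLandherr` §2):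
* all `d` from Markman's hyperbolic-sixfold statement `Markman2025_weilClasses_algebraic_hyperbolicSixfold` (arXiv:2502.03415
  Thm. 1.5.1 — PREPRINT, unrefereed in August 2026): `splitSixfoldCells_of_markman2025`;
* the refereed cells `d = 3` (Schoen 1988/1998) and `d = 1` (Koike 2004) are the instances `WeilClassesComponent 3 3 / 3 1 (split)` of the
  item's body ALREADY in the tree by name (`Ring2.AbelianAll.weilClassesComponent_split_three_three_of_schoen'`,
  `…_split_three_one_of_koike'`) — cited, not restated.
Corollary (the vhodge cell's brief «price of all Weil sixfolds», kernel form): the rung leaf `WeilSixfolds` follows from Markman's split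
theorem (preprint) plus the two non-split items `NonsplitCellsConnected` (K3 — IN PRINT modulo Deligne's period construction J1:
`SplitImpliesAllNonsplitCellsConnectedOfJ1.nonsplitCellsConnected_of_J1`, landed separately) and `NonsplitSixfoldCells` (K1, the ONE open
variational-Hodge statement), through the route's deciding theorem `SplitImpliesAll.closes`; composing with `nonsplitCellsConnected_of_J1`
gives the form «J1 ∧ Markman ∧ K1 ⟹ WeilSixfolds» (= `SplitImpliesAllNonsplitCellsConnectedOfJ1.weilSixfolds_of_J1_of_split_of_nonsplitVariational`
fed `splitSixfoldCells_of_markman2025`). Nothing here proves a case of the Hodge conjecture.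
-/

noncomputable section
set_option linter.dupNamespace false

open Literature.AlgebraicGeometry.HodgeTheory
open Summit.HodgeConjecture.HodgeConjecture.Ring2.Hypotheses
open Summit.HodgeConjecture.HodgeConjecture.Ring2.AbelianAll

namespace Summit.HodgeConjecture.HodgeConjecture.Theorems.SplitImpliesAllSplitSixfoldCellsOfMarkman

/-- **K2 ⟸ Markman BY NAME**: the residual item `SplitImpliesAll.SplitSixfoldCells` (all `d > 0`) from the UNREFEREED named fact
`Markman2025_weilClasses_algebraic_hyperbolicSixfold` alone (Landherr's converse is discharged in the tree).
[cite: Markman2025SecantWeil, Thm. 1.5.1 (preprint, unrefereed)] [cite: vanGeemen1994HodgeAV, Lemma 5.2 and (5.4.1)] -/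
theorem splitSixfoldCells_of_markman2025 (hM : Markman2025_weilClasses_algebraic_hyperbolicSixfold) :
    Summit.HodgeConjecture.HodgeConjecture.Theses.SplitImpliesAll.SplitSixfoldCells :=
  fun _ hd => weilClassesComponent_split_three_of_markmanSixfolds' hM hd

/-- **THE PRICE OF ALL WEIL SIXFOLDS beyond print, kernel form** (vhodge cell brief, seat P3): the rung leaf `WeilSixfolds` — every
rational `(3,3)` Weil class on every complex abelian sixfold of Weil type `(ℚ(√-d), all d)` is algebraic — from Markman's split theorem
(preprint named fact `hM`), the non-split cells' isogeny-connectedness to the CM anchor `NonsplitCellsConnected` (item stmt-HodgeConjecture-19825;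
IN PRINT modulo J1: `SplitImpliesAllNonsplitCellsConnectedOfJ1.nonsplitCellsConnected_of_J1`) and the ONE open statement
`NonsplitSixfoldCells` (crux stmt-HodgeConjecture-19149: one variational-Hodge instance per non-split right-sign sixfold cell at its Tate
anchor). All three are hypotheses; nothing is asserted.
[cite: Markman2025SecantWeil, Thm. 1.5.1 (preprint)] [cite: vanGeemen1994HodgeAV, Lemma 5.2 and 5.3–5.5] [cite: Deligne1982HodgeCycles, §4, proof of Thm. 4.8] -/
theorem weilSixfolds_of_markman2025_of_nonsplitCells
    (hM : Markman2025_weilClasses_algebraic_hyperbolicSixfold)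
    (hC : Summit.HodgeConjecture.HodgeConjecture.Theses.SplitImpliesAll.NonsplitCellsConnected)
    (hV : Summit.HodgeConjecture.HodgeConjecture.Theses.SplitImpliesAll.NonsplitSixfoldCells) :
    Summit.HodgeConjecture.HodgeConjecture.Theses.SevenfoldWeilCensus.WeilSixfolds :=
  Summit.HodgeConjecture.HodgeConjecture.Theses.SplitImpliesAll.closes (splitSixfoldCells_of_markman2025 hM) hV hC

/-! ### Exactness of the residual (prover lane vhodge-19150-p1, 2026-08-27)

The item K2 is not merely IMPLIED by Markman's hyperbolic-sixfold statement: it IS that statement. Ring 2 discharged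
Landherr's criterion (`Ring2AbelianAllLandherr.landherrSplitCriterion_holds`: for a Weil-type pair the `K`-symmetrised
hyperplane class is hyperbolic iff its non-degenerate discriminant class is `[(-1)ⁿ]`, van Geemen (5.4.1) via Meyer),
so the two hypotheses `IsHyperbolicWeilType A φ 3 h_K` (Markman's fact) and `HasWeilDiscriminantNondeg A φ 3 d h_K [-1]`
(the item) are interchangeable member by member, and `Ring2AbelianAllLandherr.hyperbolicSixfolds_iff_split_components'`
is the fact-free equivalence. Consequence for staffing: no argument that avoids proving arXiv:2502.03415 Thm. 1.5.1 in
the kernel — in particular no case cascade over the members of the split cell on which the Hodge conjecture is already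
a tree theorem (the CM tower `E₀³ × E₀³` by Tate, `Ring2.AbelianAll.weilComponent_cmAnchor`; stably nondegenerate
members such as `E⁶`, `CorCM.hodgeConjectureFor_powSucc_of_not_isOfCMType_of_mtRank_le_six`) — can close K2: the item
quantifies over EVERY polarized member of the 9-dimensional split cell, whose general member has `End⁰ = K` and Weil
classes outside the divisor ring (van Geemen Thm. 6.12). The refereed floor inside the item is `d = 3` (Schoen) and
`d = 1` (Koike), tree rows `weilClassesComponent_split_three_three_of_schoen'` / `…_three_one_of_koike'`. -/

/-- **K2 EXACT, FACT-FREE: `SplitSixfoldCells ↔ Markman2025_weilClasses_algebraic_hyperbolicSixfold`.** The route's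
residual item (every split sixfold cell `(ℚ(√-d), 6, [(-1)³])`, all `d > 0`) is EQUIVALENT in the kernel to the named
Literature statement of Markman's Thm. 1.5.1 (arXiv:2502.03415, preprint, UNREFEREED in August 2026) — the term is ring 2's
`hyperbolicSixfolds_iff_split_components'` (Landherr's converse discharged through Meyer's theorem), read against the
route decl. Hence the item closes exactly when that named fact is proved in the tree (`…_holds`), and by nothing weaker.
Nothing is asserted: both sides are open statements of the tree.
[cite: Markman2025SecantWeil, Thm. 1.5.1 (preprint, unrefereed)] [cite: vanGeemen1994HodgeAV, Lemma 5.2, 5.4 and (5.4.1)]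
[cite: Landherr1936HermitianForms] -/
theorem splitSixfoldCells_iff_markman2025 :
    Summit.HodgeConjecture.HodgeConjecture.Theses.SplitImpliesAll.SplitSixfoldCells ↔
      Markman2025_weilClasses_algebraic_hyperbolicSixfold :=
  hyperbolicSixfolds_iff_split_components'.symm

/-- **The rung leaf modulo print, sharpened**: granted `NonsplitCellsConnected` (K3, in print modulo J1) and the one open
variational item `NonsplitSixfoldCells` (K1), the leaf `WeilSixfolds` is EQUIVALENT to Markman's hyperbolic-sixfold statement —
`→` slices the leaf to the split cells (`Ring2.Hypotheses.weilClassesComponent_three_of_weilSixfolds`) and reads them as the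
named fact by `splitSixfoldCells_iff_markman2025`; `←` is the route's deciding theorem. Both K1 and K3 are hypotheses.
[cite: Markman2025SecantWeil, Thm. 1.5.1 (preprint, unrefereed)] [cite: vanGeemen1994HodgeAV, Lemma 5.2 and 5.3–5.5] -/
theorem weilSixfolds_iff_markman2025_of_nonsplitCells
    (hC : Summit.HodgeConjecture.HodgeConjecture.Theses.SplitImpliesAll.NonsplitCellsConnected)
    (hV : Summit.HodgeConjecture.HodgeConjecture.Theses.SplitImpliesAll.NonsplitSixfoldCells) :
    Summit.HodgeConjecture.HodgeConjecture.Theses.SevenfoldWeilCensus.WeilSixfolds ↔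
      Markman2025_weilClasses_algebraic_hyperbolicSixfold :=
  ⟨fun hW => splitSixfoldCells_iff_markman2025.1 fun _ hd => weilClassesComponent_three_of_weilSixfolds hW hd _,
    fun hM => weilSixfolds_of_markman2025_of_nonsplitCells hM hC hV⟩

end Summit.HodgeConjecture.HodgeConjecture.Theorems.SplitImpliesAllSplitSixfoldCellsOfMarkman
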